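import Mathlib
import HarnessLib
import Summits.ValiantsHypothesis.ValiantsHypothesis.Theses.MonotoneRestoration
import Literature.Computability.AlgebraicComplexity.StandardFamilies
import Literature.Computability.AlgebraicComplexity.VonZurGathenRegularity

/-! # Route MonotoneRestoration — crux `MonotoneRestorationQP`, line Sketch, stub Z13
(stmt-ValiantsHypothesis-15886)

**Cofactor expansion as a derivative.** For the generic `n × n` matrix of variables
`X = (x_ij)` (`Matrix.mvPolynomialX`), the partial derivative of the generic determinant
`detPoly (Fin n) K = det X` with respect to `x_ij` is the `(j, i)` entry of the adjugate of `X`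
(the `(i, j)` cofactor), over any commutative ring `K`.

Proof: the row-by-row derivative of a determinant (`VonZurGathen.derivation_det`,
`D (det M) = Σ_r det (M with row r := D (row r))`) for the derivation `D = ∂/∂x_ij`: the
derivative of row `r ≠ i` vanishes (so that summand is the determinant of a matrix with a zero
row), and the derivative of row `i` is the basis vector `e_j`, whose summand is
`det (X with row i := e_j) = adj(X)_{j i}` (`Matrix.adjugate_apply`).
-/

noncomputable section

-- `Summit.ValiantsHypothesis.ValiantsHypothesis.…` is the tree's mandated namespace (Sub = Summit).
set_option linter.dupNamespace false

namespace Summit.ValiantsHypothesis.ValiantsHypothesis.Theorems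

open Literature.Computability.AlgebraicComplexity

/-- The `x_ij`-derivative of row `r` of the generic matrix: the basis vector `e_j` when `r = i`,
the zero row otherwise. [folklore] -/
theorem pderiv_mvPolynomialX_row {K : Type} [CommRing K] {n : ℕ} (i j r : Fin n) :
    (fun c => MvPolynomial.pderiv (i, j) (Matrix.mvPolynomialX (Fin n) (Fin n) K r c)) =
      if r = i then Pi.single j 1 else 0 := by
  funext c
  rw [Matrix.mvPolynomialX_apply, MvPolynomial.pderiv_X]
  by_cases hr : r = i
  · subst hr
    by_cases hc : c = j
    · subst hc
      simp
    · have h : (r, c) ≠ (r, j) := fun e => hc (Prod.mk.inj e).2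
      simp [hc, h]
  · have h : (r, c) ≠ (i, j) := fun e => hr (Prod.mk.inj e).1
    simp [hr, h]

/-- **Z13 — COFACTOR EXPANSION AS A DERIVATIVE** (crux `MonotoneRestorationQP`, line Sketch;
registered stub `stub_pderiv_detPoly`). For the generic `n × n` matrix of variables `X = (x_ij)`,
`∂ det X / ∂ x_ij` is the `(j, i)` entry of the adjugate (the `(i, j)` cofactor), over any
commutative ring. Row-by-row derivative of the determinant (`VonZurGathen.derivation_det`) plus
`Matrix.adjugate_apply`. [folklore] -/
theorem stub_pderiv_detPoly {K : Type} [CommRing K] {n : ℕ} (i j : Fin n) :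
    MvPolynomial.pderiv (i, j) (detPoly (Fin n) K) =
      (Matrix.mvPolynomialX (Fin n) (Fin n) K).adjugate j i := by
  rw [detPoly, VonZurGathen.derivation_det, Finset.sum_eq_single i]
  · rw [pderiv_mvPolynomialX_row, if_pos rfl, Matrix.adjugate_apply]
  · intro r _ hr
    rw [pderiv_mvPolynomialX_row, if_neg hr]
    exact Matrix.det_eq_zero_of_row_eq_zero r fun c => by simp
  · exact fun h => absurd (Finset.mem_univ i) h

end Summit.ValiantsHypothesis.ValiantsHypothesis.Theorems

end
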